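import Summits.QuantumFields.YangMills.Theorems.UnitScaleTiltProp7RRowOfJRow
import Summits.QuantumFields.YangMills.Theorems.UnitScaleTiltProp7PlaquetteCurlComparison
import HarnessLib

/-!
# Route `UnitScaleTilt`, crux K1 «MinimiserStabilityRegPr» (stmt-QuantumFields-19200), route-R E′ growth side, ℛ-line — THE T³ READING OF ✓ `Prop7RRowOfJRow`:
# J-ROW★ (in the `B9Eq39Adjoint` Hilbert–Schmidt letters at `U := unitsField (toUField W)`) ⟹ the ℛ-ROW★ hypothesis `hR` of ✓p678151 `Prop7HKgKOfRRow.hKgK_of_RRow_kappaRow_T3`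
# VERBATIM (E′ plaquette K-letter with `Complex.I • Ds`, operator norms, `PBond`∕`Plaq` sums), so that hKg-K at a background `W` is KERNEL-COMPOSED from J-ROW★ ∧ κ-ROW′ ∧ split

Cell `ym3-torus`, width seat `ym-ust-19200-w4` (gen 7).  CHAIN OF RECORD after this file: J-ROW★(W) ⟹ [this file] `hR` ⟹ [✓p678151, with κ-ROW′ and the co-closed split] hKg-K(W).
Ingredients: ✓p684887 `RRow_of_JRow` (HS, torus letters); px15's ✓ `Prop7PlaquetteCurlComparison` (`plaqTerm_sub_curl_eq`: the door's plaquette term minus the B9 curl is a holonomy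
commutator; `sum_ite_eq_sum_plaq`); lit `MatrixNorms.opNorm_sq_le_sum_norm_sq` (op ≤ HS) and ✓ `sum_norm_sq_le_mul_opNorm_sq` (HS ≤ N·op).  THEOREMS ONLY (0 `def`, 0 `sorry`);
`--supports stmt-QuantumFields-19200`, count-neutral.  YM₃ on T³ is a ladder rung (R3), not the Clay problem; nothing here claims J-ROW★, hKg-K, S3, E′, a stub, the crux, d = 4 or
the mass gap — J-ROW★ is DISPLAYED (its inhabitant at `IsCritR2`: LOCATE v4∕v4.1, bricks ✓B-J1 ✓B-J4, open B-J2 B-J3 B-J5).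

WHAT IS PROVED (ns `…Theorems.Prop7RRowOfJRowT3`).
* §1 `plaqTerm_smul_I` (the plaquette term is `ℂ`-linear: `K_p(i•Z) = i•K_p(Z)`), ★ `norm_plaqTerm_le_curl_add` (`‖K_p(Z)‖ ≤ ‖curl_p(Z)‖ + 2a(‖Z(b₃)‖ + ‖Z(b₄)‖)`, the mirror of
  px15's `norm_curl_le_plaqTerm_add`), ★★ `plaqK_le_curlHS` (`K_W^{plaq}(i•Z) ≤ 2·CURL_HS(Z) + 32·d·a²·Σ_b‖Z b‖²`).
* §2 ★★★ `RRow_T3_of_JRow` — for `W` with `‖plaqU − 1‖ ≤ a` (all index pairs) and `dist1(W(∂p)) ≤ a` (all `p`), `0 ≤ a ≤ 1∕16`, and J-ROW★(W) with constants `C_J > 0`, `C′`: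
  the `hR` clause of ✓p678151 with `Cℛ := 4·(2C_J + C′a²ℓ²∕(2C_J) + 6·d·a·ℓ²) + 32·d·a²·ℓ²` (`ℓ = L^{K−n}`; at the member `a = α₀ℓ⁻²`: `Cℛ = 8C_J + O(α₀)`).
HONEST SCOPE.  Bookkeeping between two landed calculi; no analysis.

References: T. Bałaban, CMP 99 (1985) 389–434 [Balaban1985BackgroundPropagators] ((3.4) p.391, (3.9) p.392); CMP 102 (1985) 277–309 [Balaban1985Variational] ((47)–(48)
pp.285–286, (135) p.298, Prop. 7 p.299); CMP 98 (1985) 17–51 [Balaban1985Averaging] ((9) p.19).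
-/

set_option autoImplicit false

noncomputable section

open scoped BigOperators Matrix.Norms.L2Operator Matrix

namespace Summit.QuantumFields.YangMills.Theorems.Prop7RRowOfJRowT3

open Literature.MathematicalPhysics.QuantumFieldTheory.Balaban1983to89
open Literature.MathematicalPhysics.QuantumFieldTheory.Balaban1983to89.T3ContinuumYM3Torus
open B1RG242Torus
open B9Eq39Adjoint (R R_def covD covDstar curl plaqU)
open B10StarCount (sum_pbond)
open B10Eq27TorusAxialLog (unitsField toUField)
open B9TorusCalculus (torusT torusT_apply)
open Summit.QuantumFields.YangMills.Theorems.Prop7CovariantCoercivity (norm_conj_sub_self_le' sum_norm_sq_le_mul_opNorm_sq)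
open Summit.QuantumFields.YangMills.Theorems.Prop7CovIterLambdaBound (norm_conj_su_le)
open Summit.QuantumFields.YangMills.Theorems.Prop7CovHodgeSplit (unitsField_toUField_mem_unitary)
open Summit.QuantumFields.YangMills.Theorems.Prop7PinnedRegaugeChartDivergenceHRK (sum_plaq_le_sum_site_dir sum_site_dir_dir_shift_eq)
open Summit.QuantumFields.YangMills.Theorems.Prop7PlaquetteCurlComparison (plaqTerm_sub_curl_eq sum_ite_eq_sum_plaq)
open Summit.QuantumFields.YangMills.Theorems.Prop7RRowOfJRow (RRow_of_JRow)

/-! ## §1 The door's plaquette energy against the B9 curl energy -/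

section Generic

variable {P : Params} {N : ℕ} [NeZero N] {i : ℕ}

/-- the plaquette term is `ℂ`-linear in the bond field: `K_p(c•Z) = c•K_p(Z)`. [folklore] -/
theorem plaqTerm_smul (W : GaugeField P i (Matrix.specialUnitaryGroup (Fin N) ℂ)) (Z : PBond P i → Matrix (Fin N) (Fin N) ℂ) (c : ℂ) (p : Plaq P i) :
    (c • Z ⟨p.src, p.μ⟩
          + ((W ⟨p.src, p.μ⟩ : Matrix (Fin N) (Fin N) ℂ) * (c • Z ⟨p.src.shift p.μ, p.ν⟩) * star (W ⟨p.src, p.μ⟩ : Matrix (Fin N) (Fin N) ℂ))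
          - (((W ⟨p.src, p.μ⟩ * W ⟨p.src.shift p.μ, p.ν⟩ * (W ⟨p.src.shift p.ν, p.μ⟩)⁻¹ : Matrix.specialUnitaryGroup (Fin N) ℂ) : Matrix (Fin N) (Fin N) ℂ)
              * (c • Z ⟨p.src.shift p.ν, p.μ⟩)
              * star ((W ⟨p.src, p.μ⟩ * W ⟨p.src.shift p.μ, p.ν⟩ * (W ⟨p.src.shift p.ν, p.μ⟩)⁻¹ : Matrix.specialUnitaryGroup (Fin N) ℂ) : Matrix (Fin N) (Fin N) ℂ))
          - (((GaugeField.plaqHol W p : Matrix.specialUnitaryGroup (Fin N) ℂ) : Matrix (Fin N) (Fin N) ℂ) * (c • Z ⟨p.src, p.ν⟩)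
              * star ((GaugeField.plaqHol W p : Matrix.specialUnitaryGroup (Fin N) ℂ) : Matrix (Fin N) (Fin N) ℂ)))
      = c • (Z ⟨p.src, p.μ⟩
          + ((W ⟨p.src, p.μ⟩ : Matrix (Fin N) (Fin N) ℂ) * Z ⟨p.src.shift p.μ, p.ν⟩ * star (W ⟨p.src, p.μ⟩ : Matrix (Fin N) (Fin N) ℂ))
          - (((W ⟨p.src, p.μ⟩ * W ⟨p.src.shift p.μ, p.ν⟩ * (W ⟨p.src.shift p.ν, p.μ⟩)⁻¹ : Matrix.specialUnitaryGroup (Fin N) ℂ) : Matrix (Fin N) (Fin N) ℂ)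
              * Z ⟨p.src.shift p.ν, p.μ⟩
              * star ((W ⟨p.src, p.μ⟩ * W ⟨p.src.shift p.μ, p.ν⟩ * (W ⟨p.src.shift p.ν, p.μ⟩)⁻¹ : Matrix.specialUnitaryGroup (Fin N) ℂ) : Matrix (Fin N) (Fin N) ℂ))
          - (((GaugeField.plaqHol W p : Matrix.specialUnitaryGroup (Fin N) ℂ) : Matrix (Fin N) (Fin N) ℂ) * Z ⟨p.src, p.ν⟩
              * star ((GaugeField.plaqHol W p : Matrix.specialUnitaryGroup (Fin N) ℂ) : Matrix (Fin N) (Fin N) ℂ))) := by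
  simp only [Matrix.mul_smul, Matrix.smul_mul, smul_add, smul_sub]

/-- ★ **THE PLAQUETTE TERM AGAINST THE CURL** (mirror of px15's `norm_curl_le_plaqTerm_add`): under `dist1(W(∂p)) ≤ a`,
`‖K_p(Z)‖ ≤ ‖curl_p(Z)‖ + 2a·(‖Z(b₃)‖ + ‖Z(b₄)‖)`. [cite: Balaban1985Variational, (47)-(48) pp.285-286] -/
theorem norm_plaqTerm_le_curl_add (W : GaugeField P i (Matrix.specialUnitaryGroup (Fin N) ℂ)) {a : ℝ}
    (hU : ∀ p : Plaq P i, dist1 (GaugeField.plaqHol W p) ≤ a) (Z : PBond P i → Matrix (Fin N) (Fin N) ℂ) (p : Plaq P i) :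
    ‖(Z ⟨p.src, p.μ⟩
          + ((W ⟨p.src, p.μ⟩ : Matrix (Fin N) (Fin N) ℂ) * Z ⟨p.src.shift p.μ, p.ν⟩ * star (W ⟨p.src, p.μ⟩ : Matrix (Fin N) (Fin N) ℂ))
          - (((W ⟨p.src, p.μ⟩ * W ⟨p.src.shift p.μ, p.ν⟩ * (W ⟨p.src.shift p.ν, p.μ⟩)⁻¹ : Matrix.specialUnitaryGroup (Fin N) ℂ) : Matrix (Fin N) (Fin N) ℂ)
              * Z ⟨p.src.shift p.ν, p.μ⟩
              * star ((W ⟨p.src, p.μ⟩ * W ⟨p.src.shift p.μ, p.ν⟩ * (W ⟨p.src.shift p.ν, p.μ⟩)⁻¹ : Matrix.specialUnitaryGroup (Fin N) ℂ) : Matrix (Fin N) (Fin N) ℂ))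
          - (((GaugeField.plaqHol W p : Matrix.specialUnitaryGroup (Fin N) ℂ) : Matrix (Fin N) (Fin N) ℂ) * Z ⟨p.src, p.ν⟩
              * star ((GaugeField.plaqHol W p : Matrix.specialUnitaryGroup (Fin N) ℂ) : Matrix (Fin N) (Fin N) ℂ)))‖
      ≤ ‖curl (torusT P i) (fun κ z => unitsField (toUField W) ⟨z, κ⟩) (fun κ z => Z ⟨z, κ⟩) p.μ p.ν p.src‖ + 2 * a * (‖Z ⟨p.src.shift p.ν, p.μ⟩‖ + ‖Z ⟨p.src, p.ν⟩‖) := by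
  have ha : ‖((GaugeField.plaqHol W p : Matrix.specialUnitaryGroup (Fin N) ℂ) : Matrix (Fin N) (Fin N) ℂ) - 1‖ ≤ a := hU p
  have ha0 : 0 ≤ a := (norm_nonneg _).trans ha
  have hdiff := plaqTerm_sub_curl_eq W Z p
  have hX : ‖(W ⟨p.src, p.ν⟩ : Matrix (Fin N) (Fin N) ℂ) * Z ⟨p.src.shift p.ν, p.μ⟩ * star (W ⟨p.src, p.ν⟩ : Matrix (Fin N) (Fin N) ℂ) + Z ⟨p.src, p.ν⟩‖
      ≤ ‖Z ⟨p.src.shift p.ν, p.μ⟩‖ + ‖Z ⟨p.src, p.ν⟩‖ :=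
    (norm_add_le _ _).trans (add_le_add (norm_conj_su_le _ _) le_rfl)
  have hcomm := norm_conj_sub_self_le' (GaugeField.plaqHol W p)
    ((W ⟨p.src, p.ν⟩ : Matrix (Fin N) (Fin N) ℂ) * Z ⟨p.src.shift p.ν, p.μ⟩ * star (W ⟨p.src, p.ν⟩ : Matrix (Fin N) (Fin N) ℂ) + Z ⟨p.src, p.ν⟩)
  have hKc : ‖(Z ⟨p.src, p.μ⟩
          + ((W ⟨p.src, p.μ⟩ : Matrix (Fin N) (Fin N) ℂ) * Z ⟨p.src.shift p.μ, p.ν⟩ * star (W ⟨p.src, p.μ⟩ : Matrix (Fin N) (Fin N) ℂ))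
          - (((W ⟨p.src, p.μ⟩ * W ⟨p.src.shift p.μ, p.ν⟩ * (W ⟨p.src.shift p.ν, p.μ⟩)⁻¹ : Matrix.specialUnitaryGroup (Fin N) ℂ) : Matrix (Fin N) (Fin N) ℂ)
              * Z ⟨p.src.shift p.ν, p.μ⟩
              * star ((W ⟨p.src, p.μ⟩ * W ⟨p.src.shift p.μ, p.ν⟩ * (W ⟨p.src.shift p.ν, p.μ⟩)⁻¹ : Matrix.specialUnitaryGroup (Fin N) ℂ) : Matrix (Fin N) (Fin N) ℂ))
          - (((GaugeField.plaqHol W p : Matrix.specialUnitaryGroup (Fin N) ℂ) : Matrix (Fin N) (Fin N) ℂ) * Z ⟨p.src, p.ν⟩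
              * star ((GaugeField.plaqHol W p : Matrix.specialUnitaryGroup (Fin N) ℂ) : Matrix (Fin N) (Fin N) ℂ)))
        - curl (torusT P i) (fun κ z => unitsField (toUField W) ⟨z, κ⟩) (fun κ z => Z ⟨z, κ⟩) p.μ p.ν p.src‖
      ≤ 2 * a * (‖Z ⟨p.src.shift p.ν, p.μ⟩‖ + ‖Z ⟨p.src, p.ν⟩‖) := by
    rw [hdiff, norm_neg]
    refine hcomm.trans ?_
    exact mul_le_mul (by linarith) hX (norm_nonneg _) (by positivity)
  have key := norm_le_insert' ((Z ⟨p.src, p.μ⟩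
          + ((W ⟨p.src, p.μ⟩ : Matrix (Fin N) (Fin N) ℂ) * Z ⟨p.src.shift p.μ, p.ν⟩ * star (W ⟨p.src, p.μ⟩ : Matrix (Fin N) (Fin N) ℂ))
          - (((W ⟨p.src, p.μ⟩ * W ⟨p.src.shift p.μ, p.ν⟩ * (W ⟨p.src.shift p.ν, p.μ⟩)⁻¹ : Matrix.specialUnitaryGroup (Fin N) ℂ) : Matrix (Fin N) (Fin N) ℂ)
              * Z ⟨p.src.shift p.ν, p.μ⟩
              * star ((W ⟨p.src, p.μ⟩ * W ⟨p.src.shift p.μ, p.ν⟩ * (W ⟨p.src.shift p.ν, p.μ⟩)⁻¹ : Matrix.specialUnitaryGroup (Fin N) ℂ) : Matrix (Fin N) (Fin N) ℂ))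
          - (((GaugeField.plaqHol W p : Matrix.specialUnitaryGroup (Fin N) ℂ) : Matrix (Fin N) (Fin N) ℂ) * Z ⟨p.src, p.ν⟩
              * star ((GaugeField.plaqHol W p : Matrix.specialUnitaryGroup (Fin N) ℂ) : Matrix (Fin N) (Fin N) ℂ)))) (curl (torusT P i) (fun κ z => unitsField (toUField W) ⟨z, κ⟩) (fun κ z => Z ⟨z, κ⟩) p.μ p.ν p.src)
  have e : ‖curl (torusT P i) (fun κ z => unitsField (toUField W) ⟨z, κ⟩) (fun κ z => Z ⟨z, κ⟩) p.μ p.ν p.src - (Z ⟨p.src, p.μ⟩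
          + ((W ⟨p.src, p.μ⟩ : Matrix (Fin N) (Fin N) ℂ) * Z ⟨p.src.shift p.μ, p.ν⟩ * star (W ⟨p.src, p.μ⟩ : Matrix (Fin N) (Fin N) ℂ))
          - (((W ⟨p.src, p.μ⟩ * W ⟨p.src.shift p.μ, p.ν⟩ * (W ⟨p.src.shift p.ν, p.μ⟩)⁻¹ : Matrix.specialUnitaryGroup (Fin N) ℂ) : Matrix (Fin N) (Fin N) ℂ)
              * Z ⟨p.src.shift p.ν, p.μ⟩
              * star ((W ⟨p.src, p.μ⟩ * W ⟨p.src.shift p.μ, p.ν⟩ * (W ⟨p.src.shift p.ν, p.μ⟩)⁻¹ : Matrix.specialUnitaryGroup (Fin N) ℂ) : Matrix (Fin N) (Fin N) ℂ))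
          - (((GaugeField.plaqHol W p : Matrix.specialUnitaryGroup (Fin N) ℂ) : Matrix (Fin N) (Fin N) ℂ) * Z ⟨p.src, p.ν⟩
              * star ((GaugeField.plaqHol W p : Matrix.specialUnitaryGroup (Fin N) ℂ) : Matrix (Fin N) (Fin N) ℂ)))‖ = ‖(Z ⟨p.src, p.μ⟩
          + ((W ⟨p.src, p.μ⟩ : Matrix (Fin N) (Fin N) ℂ) * Z ⟨p.src.shift p.μ, p.ν⟩ * star (W ⟨p.src, p.μ⟩ : Matrix (Fin N) (Fin N) ℂ))
          - (((W ⟨p.src, p.μ⟩ * W ⟨p.src.shift p.μ, p.ν⟩ * (W ⟨p.src.shift p.ν, p.μ⟩)⁻¹ : Matrix.specialUnitaryGroup (Fin N) ℂ) : Matrix (Fin N) (Fin N) ℂ)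
              * Z ⟨p.src.shift p.ν, p.μ⟩
              * star ((W ⟨p.src, p.μ⟩ * W ⟨p.src.shift p.μ, p.ν⟩ * (W ⟨p.src.shift p.ν, p.μ⟩)⁻¹ : Matrix.specialUnitaryGroup (Fin N) ℂ) : Matrix (Fin N) (Fin N) ℂ))
          - (((GaugeField.plaqHol W p : Matrix.specialUnitaryGroup (Fin N) ℂ) : Matrix (Fin N) (Fin N) ℂ) * Z ⟨p.src, p.ν⟩
              * star ((GaugeField.plaqHol W p : Matrix.specialUnitaryGroup (Fin N) ℂ) : Matrix (Fin N) (Fin N) ℂ))) - curl (torusT P i) (fun κ z => unitsField (toUField W) ⟨z, κ⟩) (fun κ z => Z ⟨z, κ⟩) p.μ p.ν p.src‖ := norm_sub_rev _ _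
  linarith

/-- ★★ **THE DOOR'S PLAQUETTE ENERGY AGAINST THE B9 CURL ENERGY**: for an `SU(N)` background with `dist1(W(∂p)) ≤ a` and any bond field `Z`,
`K_W^{plaq}(i•Z) ≤ 2·CURL_HS(Z) + 32·d·a²·Σ_b‖Z b‖²` (the converse direction of px15's `curlHS_le_plaqK`, without the factor `N`: op ≤ HS).
[cite: Balaban1985Variational, (47)-(48) pp.285-286, (135) p.298; Balaban1985BackgroundPropagators, (3.4) p.391] -/
theorem plaqK_le_curlHS (W : GaugeField P i (Matrix.specialUnitaryGroup (Fin N) ℂ)) {a : ℝ}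
    (hU : ∀ p : Plaq P i, dist1 (GaugeField.plaqHol W p) ≤ a) (Z : PBond P i → Matrix (Fin N) (Fin N) ℂ) :
    (∑ p : Plaq P i, ‖((Complex.I • Z ⟨p.src, p.μ⟩)
          + ((W ⟨p.src, p.μ⟩ : Matrix (Fin N) (Fin N) ℂ) * (Complex.I • Z ⟨p.src.shift p.μ, p.ν⟩) * star (W ⟨p.src, p.μ⟩ : Matrix (Fin N) (Fin N) ℂ))
          - (((W ⟨p.src, p.μ⟩ * W ⟨p.src.shift p.μ, p.ν⟩ * (W ⟨p.src.shift p.ν, p.μ⟩)⁻¹ : Matrix.specialUnitaryGroup (Fin N) ℂ) : Matrix (Fin N) (Fin N) ℂ)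
              * (Complex.I • Z ⟨p.src.shift p.ν, p.μ⟩)
              * star ((W ⟨p.src, p.μ⟩ * W ⟨p.src.shift p.μ, p.ν⟩ * (W ⟨p.src.shift p.ν, p.μ⟩)⁻¹ : Matrix.specialUnitaryGroup (Fin N) ℂ) : Matrix (Fin N) (Fin N) ℂ))
          - (((GaugeField.plaqHol W p : Matrix.specialUnitaryGroup (Fin N) ℂ) : Matrix (Fin N) (Fin N) ℂ) * (Complex.I • Z ⟨p.src, p.ν⟩)
              * star ((GaugeField.plaqHol W p : Matrix.specialUnitaryGroup (Fin N) ℂ) : Matrix (Fin N) (Fin N) ℂ)))‖ ^ 2)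
      ≤ 2 * (∑ x : Site P i, ∑ μ : Fin P.d, ∑ ν : Fin P.d,
          (if μ < ν then ∑ j : Fin N, ∑ k : Fin N, ‖(curl (torusT P i) (fun κ z => unitsField (toUField W) ⟨z, κ⟩) (fun κ z => Z ⟨z, κ⟩) μ ν x) j k‖ ^ 2 else 0))
        + 32 * P.d * a ^ 2 * ∑ b : PBond P i, ‖Z b‖ ^ 2 := by
  -- pull `i` out and square the pointwise bound
  have hpt : ∀ p : Plaq P i, ‖((Complex.I • Z ⟨p.src, p.μ⟩)
          + ((W ⟨p.src, p.μ⟩ : Matrix (Fin N) (Fin N) ℂ) * (Complex.I • Z ⟨p.src.shift p.μ, p.ν⟩) * star (W ⟨p.src, p.μ⟩ : Matrix (Fin N) (Fin N) ℂ))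
          - (((W ⟨p.src, p.μ⟩ * W ⟨p.src.shift p.μ, p.ν⟩ * (W ⟨p.src.shift p.ν, p.μ⟩)⁻¹ : Matrix.specialUnitaryGroup (Fin N) ℂ) : Matrix (Fin N) (Fin N) ℂ)
              * (Complex.I • Z ⟨p.src.shift p.ν, p.μ⟩)
              * star ((W ⟨p.src, p.μ⟩ * W ⟨p.src.shift p.μ, p.ν⟩ * (W ⟨p.src.shift p.ν, p.μ⟩)⁻¹ : Matrix.specialUnitaryGroup (Fin N) ℂ) : Matrix (Fin N) (Fin N) ℂ))
          - (((GaugeField.plaqHol W p : Matrix.specialUnitaryGroup (Fin N) ℂ) : Matrix (Fin N) (Fin N) ℂ) * (Complex.I • Z ⟨p.src, p.ν⟩)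
              * star ((GaugeField.plaqHol W p : Matrix.specialUnitaryGroup (Fin N) ℂ) : Matrix (Fin N) (Fin N) ℂ)))‖ ^ 2
      ≤ 2 * ∑ j : Fin N, ∑ k : Fin N, ‖(curl (torusT P i) (fun κ z => unitsField (toUField W) ⟨z, κ⟩) (fun κ z => Z ⟨z, κ⟩) p.μ p.ν p.src) j k‖ ^ 2
        + 16 * a ^ 2 * (‖Z ⟨p.src.shift p.ν, p.μ⟩‖ ^ 2 + ‖Z ⟨p.src, p.ν⟩‖ ^ 2) := by
    intro p
    have ha0 : 0 ≤ a := by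
      have ha : ‖((GaugeField.plaqHol W p : Matrix.specialUnitaryGroup (Fin N) ℂ) : Matrix (Fin N) (Fin N) ℂ) - 1‖ ≤ a := hU p
      exact (norm_nonneg _).trans ha
    rw [plaqTerm_smul W Z Complex.I p, norm_smul, Complex.norm_I, one_mul]
    have h := norm_plaqTerm_le_curl_add W hU Z p
    have h0 : 0 ≤ ‖(Z ⟨p.src, p.μ⟩
          + ((W ⟨p.src, p.μ⟩ : Matrix (Fin N) (Fin N) ℂ) * Z ⟨p.src.shift p.μ, p.ν⟩ * star (W ⟨p.src, p.μ⟩ : Matrix (Fin N) (Fin N) ℂ))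
          - (((W ⟨p.src, p.μ⟩ * W ⟨p.src.shift p.μ, p.ν⟩ * (W ⟨p.src.shift p.ν, p.μ⟩)⁻¹ : Matrix.specialUnitaryGroup (Fin N) ℂ) : Matrix (Fin N) (Fin N) ℂ)
              * Z ⟨p.src.shift p.ν, p.μ⟩
              * star ((W ⟨p.src, p.μ⟩ * W ⟨p.src.shift p.μ, p.ν⟩ * (W ⟨p.src.shift p.ν, p.μ⟩)⁻¹ : Matrix.specialUnitaryGroup (Fin N) ℂ) : Matrix (Fin N) (Fin N) ℂ))
          - (((GaugeField.plaqHol W p : Matrix.specialUnitaryGroup (Fin N) ℂ) : Matrix (Fin N) (Fin N) ℂ) * Z ⟨p.src, p.ν⟩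
              * star ((GaugeField.plaqHol W p : Matrix.specialUnitaryGroup (Fin N) ℂ) : Matrix (Fin N) (Fin N) ℂ)))‖ := norm_nonneg _
    have hsq := pow_le_pow_left₀ h0 h 2
    have hop : ‖curl (torusT P i) (fun κ z => unitsField (toUField W) ⟨z, κ⟩) (fun κ z => Z ⟨z, κ⟩) p.μ p.ν p.src‖ ^ 2 ≤ ∑ j : Fin N, ∑ k : Fin N, ‖(curl (torusT P i) (fun κ z => unitsField (toUField W) ⟨z, κ⟩) (fun κ z => Z ⟨z, κ⟩) p.μ p.ν p.src) j k‖ ^ 2 := MatrixNorms.opNorm_sq_le_sum_norm_sq _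
    nlinarith [hsq, hop, sq_nonneg (‖curl (torusT P i) (fun κ z => unitsField (toUField W) ⟨z, κ⟩) (fun κ z => Z ⟨z, κ⟩) p.μ p.ν p.src‖ - 2 * a * (‖Z ⟨p.src.shift p.ν, p.μ⟩‖ + ‖Z ⟨p.src, p.ν⟩‖)),
      sq_nonneg (‖Z ⟨p.src.shift p.ν, p.μ⟩‖ - ‖Z ⟨p.src, p.ν⟩‖), mul_nonneg ha0 (norm_nonneg (Z ⟨p.src.shift p.ν, p.μ⟩)),
      mul_nonneg ha0 (norm_nonneg (Z ⟨p.src, p.ν⟩)), norm_nonneg (curl (torusT P i) (fun κ z => unitsField (toUField W) ⟨z, κ⟩) (fun κ z => Z ⟨z, κ⟩) p.μ p.ν p.src)]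
  refine (Finset.sum_le_sum fun p _ => hpt p).trans ?_
  rw [Finset.sum_add_distrib, ← Finset.mul_sum, ← Finset.mul_sum,
    ← sum_ite_eq_sum_plaq (fun x μ ν => ∑ j : Fin N, ∑ k : Fin N,
      ‖(curl (torusT P i) (fun κ z => unitsField (toUField W) ⟨z, κ⟩) (fun κ z => Z ⟨z, κ⟩) μ ν x) j k‖ ^ 2)]
  have hslots : ∑ p : Plaq P i, (‖Z ⟨p.src.shift p.ν, p.μ⟩‖ ^ 2 + ‖Z ⟨p.src, p.ν⟩‖ ^ 2) ≤ 2 * P.d * ∑ b : PBond P i, ‖Z b‖ ^ 2 := by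
    have hle := sum_plaq_le_sum_site_dir (P := P) (i := i) (fun x μ ν => ‖Z ⟨x.shift ν, μ⟩‖ ^ 2 + ‖Z ⟨x, ν⟩‖ ^ 2) (fun x μ ν => by positivity)
    refine hle.trans (le_of_eq ?_)
    obtain ⟨-, -, e3, e4⟩ := sum_site_dir_dir_shift_eq (P := P) (i := i) Z
    simp only [Finset.sum_add_distrib]
    rw [e3, e4]; ring
  have ha2 : (0 : ℝ) ≤ 16 * a ^ 2 := by positivity
  nlinarith [mul_le_mul_of_nonneg_left hslots ha2]

end Generic

/-! ## §2 ★★★ The `hR` clause of ✓p678151 from J-ROW★ -/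

/-- ★★★ **ℛ-ROW★ IN THE LETTERS OF ✓p678151, FROM J-ROW★.**  `F` a T³ family, run `K`, comparison height `n`, `ℓ = L^{K−n}`; `W` an SU(2) background with `‖plaqU − 1‖ ≤ a` for all
index pairs (✓`norm_plaqU_sub_one_le_of_regPr`) and `dist1(W(∂p)) ≤ a` for all `p` (✓`dist1_plaqHol_le_of_mem_regFibrePr`), `0 ≤ a`, `16a ≤ 1`; J-ROW★(W) DISPLAYED in the HS torus
letters of ✓p684887 at `U := unitsField (toUField W)`, `w := ℓ²`, constants `0 < C_J`, `C′`.  THEN the `hR` hypothesis of ✓ `Prop7HKgKOfRRow.hKgK_of_RRow_kappaRow_T3` holds with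
`Cℛ := 4·(2C_J + C′a²ℓ²∕(2C_J) + 6·d·a·ℓ²) + 32·d·a²·ℓ²`. [cite: Balaban1985Variational, Prop. 7 p.299, (135) p.298; Balaban1985BackgroundPropagators, (3.9) p.392] -/
theorem RRow_T3_of_JRow (F : T3Family) (K n : ℕ) (W : GaugeField (F.P K) 0 (Matrix.specialUnitaryGroup (Fin 2) ℂ)) {a : ℝ} (ha0 : 0 ≤ a)
    (hpU : ∀ (μ ν : Fin (F.P K).d) (x : Site (F.P K) 0), ‖(plaqU (torusT (F.P K) 0) (fun κ z => unitsField (toUField W) ⟨z, κ⟩) μ ν x : Matrix (Fin 2) (Fin 2) ℂ) - 1‖ ≤ a)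
    (hpH : ∀ p : Plaq (F.P K) 0, dist1 (GaugeField.plaqHol W p) ≤ a) (ha16 : 16 * a ≤ 1)
    {C_J C' : ℝ} (hCJ : 0 < C_J) (hC' : 0 ≤ C')
    (hJ : ∀ φ : Site (F.P K) 0 → Matrix (Fin 2) (Fin 2) ℂ,
      ((F.L : ℝ) ^ (K - n)) ^ 2 * (∑ x : Site (F.P K) 0, ∑ μ : Fin (F.P K).d, ∑ j : Fin 2, ∑ k : Fin 2,
        ‖(∑ ν : Fin (F.P K).d,
            (R (((fun κ z => unitsField (toUField W) ⟨z, κ⟩) ν (x.unshift ν))⁻¹ * plaqU (torusT (F.P K) 0) (fun κ z => unitsField (toUField W) ⟨z, κ⟩) ν μ (x.unshift ν) * (fun κ z => unitsField (toUField W) ⟨z, κ⟩) ν (x.unshift ν))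
                  (R ((fun κ z => unitsField (toUField W) ⟨z, κ⟩) ν (x.unshift ν))⁻¹ (R ((fun κ z => unitsField (toUField W) ⟨z, κ⟩) μ (x.unshift ν) * (fun κ z => unitsField (toUField W) ⟨z, κ⟩) ν ((x.unshift ν).shift μ)) (φ (((x.unshift ν).shift μ).shift ν))))
              - R (plaqU (torusT (F.P K) 0) (fun κ z => unitsField (toUField W) ⟨z, κ⟩) ν μ x)
                  (R ((fun κ z => unitsField (toUField W) ⟨z, κ⟩) ν (x.unshift ν))⁻¹ (R ((fun κ z => unitsField (toUField W) ⟨z, κ⟩) μ (x.unshift ν) * (fun κ z => unitsField (toUField W) ⟨z, κ⟩) ν ((x.unshift ν).shift μ)) (φ (((x.unshift ν).shift μ).shift ν)))))) j k‖ ^ 2)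
      ≤ C_J * (∑ x : Site (F.P K) 0, ∑ μ : Fin (F.P K).d, ∑ ν : Fin (F.P K).d, (if μ < ν then
        ∑ j : Fin 2, ∑ k : Fin 2, ‖(curl (torusT (F.P K) 0) (fun κ z => unitsField (toUField W) ⟨z, κ⟩) (fun κ => covD (torusT (F.P K) 0) (fun κ z => unitsField (toUField W) ⟨z, κ⟩) κ φ) μ ν x) j k‖ ^ 2 else 0))
        + C' * a ^ 2 * (∑ x : Site (F.P K) 0, ∑ μ : Fin (F.P K).d, ∑ j : Fin 2, ∑ k : Fin 2, ‖(covD (torusT (F.P K) 0) (fun κ z => unitsField (toUField W) ⟨z, κ⟩) μ φ x) j k‖ ^ 2)) :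
    ∀ (s : Site (F.P K) 0 → Matrix (Fin 2) (Fin 2) ℂ) (Ds : PBond (F.P K) 0 → Matrix (Fin 2) (Fin 2) ℂ),
      (∀ b : PBond (F.P K) 0, Ds b = covD (torusT (F.P K) 0) (fun κ z => unitsField (toUField W) ⟨z, κ⟩) b.dir s b.src) →
        (((F.L : ℝ) ^ (K - n)) ^ 2) * (∑ p : Plaq (F.P K) 0, ‖((Complex.I • Ds ⟨p.src, p.μ⟩) + ((W ⟨p.src, p.μ⟩ : Matrix (Fin 2) (Fin 2) ℂ) * (Complex.I • Ds ⟨p.src.shift p.μ, p.ν⟩) * star (W ⟨p.src, p.μ⟩ : Matrix (Fin 2) (Fin 2) ℂ))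
            - (((W ⟨p.src, p.μ⟩ * W ⟨p.src.shift p.μ, p.ν⟩ * (W ⟨p.src.shift p.ν, p.μ⟩)⁻¹ : Matrix.specialUnitaryGroup (Fin 2) ℂ) : Matrix (Fin 2) (Fin 2) ℂ) * (Complex.I • Ds ⟨p.src.shift p.ν, p.μ⟩) * star ((W ⟨p.src, p.μ⟩ * W ⟨p.src.shift p.μ, p.ν⟩ * (W ⟨p.src.shift p.ν, p.μ⟩)⁻¹ : Matrix.specialUnitaryGroup (Fin 2) ℂ) : Matrix (Fin 2) (Fin 2) ℂ))
            - (((GaugeField.plaqHol W p : Matrix.specialUnitaryGroup (Fin 2) ℂ) : Matrix (Fin 2) (Fin 2) ℂ) * (Complex.I • Ds ⟨p.src, p.ν⟩) * star ((GaugeField.plaqHol W p : Matrix.specialUnitaryGroup (Fin 2) ℂ) : Matrix (Fin 2) (Fin 2) ℂ)))‖ ^ 2)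
          ≤ (4 * (2 * C_J + C' * a ^ 2 * ((F.L : ℝ) ^ (K - n)) ^ 2 / (2 * C_J) + 6 * (F.P K).d * a * ((F.L : ℝ) ^ (K - n)) ^ 2)
              + 32 * (F.P K).d * a ^ 2 * ((F.L : ℝ) ^ (K - n)) ^ 2) * (∑ b : PBond (F.P K) 0, ‖Ds b‖ ^ 2) := by
  intro s Ds hDs
  have hUu : ∀ (ν : Fin (F.P K).d) (x : Site (F.P K) 0), (((fun κ z => unitsField (toUField W) ⟨z, κ⟩) ν x : (Matrix (Fin 2) (Fin 2) ℂ)ˣ) : Matrix (Fin 2) (Fin 2) ℂ)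
      ∈ unitary (Matrix (Fin 2) (Fin 2) ℂ) := fun ν x => unitsField_toUField_mem_unitary W ν x
  have hL1 : (1 : ℝ) ≤ F.L := by exact_mod_cast F.hL.2.le
  have hw : (0 : ℝ) < ((F.L : ℝ) ^ (K - n)) ^ 2 := by
    have : (0 : ℝ) < F.L := by linarith
    positivity
  set w : ℝ := ((F.L : ℝ) ^ (K - n)) ^ 2 with hwdef
  -- (1) the door in HS letters
  have hdoor := RRow_of_JRow (fun κ z => unitsField (toUField W) ⟨z, κ⟩) hUu ha0 hpU ha16 s hCJ hw (hJ s)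
  -- (2) the plaquette energy against the HS curl energy, with `Z := Ds`
  have hcmp := plaqK_le_curlHS W hpH Ds
  -- (3) identify the curl of `Ds` with the curl of `D_U s`, and the HS mass with `≤ 2·Σ_b‖Ds b‖²`
  have hDs' : (fun κ z => Ds ⟨z, κ⟩) = fun κ => covD (torusT (F.P K) 0) (fun κ z => unitsField (toUField W) ⟨z, κ⟩) κ s := by
    funext κ z; exact hDs ⟨z, κ⟩
  rw [hDs'] at hcmp
  have hM : ∑ x : Site (F.P K) 0, ∑ μ : Fin (F.P K).d, ∑ j : Fin 2, ∑ k : Fin 2, ‖(covD (torusT (F.P K) 0) (fun κ z => unitsField (toUField W) ⟨z, κ⟩) μ s x) j k‖ ^ 2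
      ≤ 2 * ∑ b : PBond (F.P K) 0, ‖Ds b‖ ^ 2 := by
    rw [sum_pbond, Finset.mul_sum]
    refine Finset.sum_le_sum fun x _ => ?_
    rw [Finset.mul_sum]
    refine Finset.sum_le_sum fun μ _ => ?_
    rw [hDs ⟨x, μ⟩]
    have h := sum_norm_sq_le_mul_opNorm_sq (covD (torusT (F.P K) 0) (fun κ z => unitsField (toUField W) ⟨z, κ⟩) μ s x)
    simpa using h
  -- (4) assemble (abbreviate the five energies; all closed terms)
  set KH : ℝ := ∑ x : Site (F.P K) 0, ∑ μ : Fin (F.P K).d, ∑ ν : Fin (F.P K).d, (if μ < ν then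
        ∑ j : Fin 2, ∑ k : Fin 2, ‖(curl (torusT (F.P K) 0) (fun κ z => unitsField (toUField W) ⟨z, κ⟩) (fun κ => covD (torusT (F.P K) 0) (fun κ z => unitsField (toUField W) ⟨z, κ⟩) κ s) μ ν x) j k‖ ^ 2 else 0) with hKH
  set MH : ℝ := ∑ x : Site (F.P K) 0, ∑ μ : Fin (F.P K).d, ∑ j : Fin 2, ∑ k : Fin 2, ‖(covD (torusT (F.P K) 0) (fun κ z => unitsField (toUField W) ⟨z, κ⟩) μ s x) j k‖ ^ 2 with hMH
  set Mb : ℝ := ∑ b : PBond (F.P K) 0, ‖Ds b‖ ^ 2 with hMb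
  set KP : ℝ := (∑ p : Plaq (F.P K) 0, ‖((Complex.I • Ds ⟨p.src, p.μ⟩) + ((W ⟨p.src, p.μ⟩ : Matrix (Fin 2) (Fin 2) ℂ) * (Complex.I • Ds ⟨p.src.shift p.μ, p.ν⟩) * star (W ⟨p.src, p.μ⟩ : Matrix (Fin 2) (Fin 2) ℂ))
            - (((W ⟨p.src, p.μ⟩ * W ⟨p.src.shift p.μ, p.ν⟩ * (W ⟨p.src.shift p.ν, p.μ⟩)⁻¹ : Matrix.specialUnitaryGroup (Fin 2) ℂ) : Matrix (Fin 2) (Fin 2) ℂ) * (Complex.I • Ds ⟨p.src.shift p.ν, p.μ⟩) * star ((W ⟨p.src, p.μ⟩ * W ⟨p.src.shift p.μ, p.ν⟩ * (W ⟨p.src.shift p.ν, p.μ⟩)⁻¹ : Matrix.specialUnitaryGroup (Fin 2) ℂ) : Matrix (Fin 2) (Fin 2) ℂ))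
            - (((GaugeField.plaqHol W p : Matrix.specialUnitaryGroup (Fin 2) ℂ) : Matrix (Fin 2) (Fin 2) ℂ) * (Complex.I • Ds ⟨p.src, p.ν⟩) * star ((GaugeField.plaqHol W p : Matrix.specialUnitaryGroup (Fin 2) ℂ) : Matrix (Fin 2) (Fin 2) ℂ)))‖ ^ 2) with hKP
  have hKH0 : 0 ≤ KH := by
    rw [hKH]
    exact Finset.sum_nonneg fun _ _ => Finset.sum_nonneg fun _ _ => Finset.sum_nonneg fun _ _ => by
      split_ifs
      · exact Finset.sum_nonneg fun _ _ => Finset.sum_nonneg fun _ _ => sq_nonneg _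
      · exact le_rfl
  have hMb0 : 0 ≤ Mb := by rw [hMb]; exact Finset.sum_nonneg fun _ _ => sq_nonneg _
  have hd0 : (0 : ℝ) ≤ (F.P K).d := Nat.cast_nonneg _
  set C₁ : ℝ := 2 * C_J + C' * a ^ 2 * w / (2 * C_J) + 6 * (F.P K).d * a * w with hC₁
  have hC1 : 0 ≤ C₁ := by rw [hC₁]; positivity
  clear_value KH MH Mb KP C₁
  -- `w·KP ≤ w·(2KH + 32 d a² Mb)`, `w·KH ≤ C₁·MH`, `C₁·MH ≤ 2C₁·Mb`
  have h1 : w * KP ≤ w * (2 * KH + 32 * (F.P K).d * a ^ 2 * Mb) := mul_le_mul_of_nonneg_left hcmp hw.le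
  have h3 : C₁ * MH ≤ C₁ * (2 * Mb) := mul_le_mul_of_nonneg_left hM hC1
  have e1 : w * (2 * KH + 32 * (F.P K).d * a ^ 2 * Mb) = 2 * (w * KH) + 32 * (F.P K).d * a ^ 2 * w * Mb := by ring
  have e2 : (4 * C₁ + 32 * (F.P K).d * a ^ 2 * w) * Mb = 2 * (C₁ * (2 * Mb)) + 32 * (F.P K).d * a ^ 2 * w * Mb := by ring
  rw [e2]
  rw [e1] at h1
  linarith only [h1, hdoor, h3]

end Summit.QuantumFields.YangMills.Theorems.Prop7RRowOfJRowT3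

end
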